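import Summits.ValiantsHypothesis.ValiantsHypothesis.Theorems.SymPencilPerFourCoordinateRadical
import Summits.ValiantsHypothesis.ValiantsHypothesis.Theorems.SymPencilBoxFourEquality

/-!
# Route `SymPencil` — an EXOTIC `6`-dimensional subspace of `Sing Z(per_4)`
# (`--supports` stmt-ValiantsHypothesis-5674 `SdcSuperquadratic`; negative calibration for the sizes
# `24, 25` of the ladder `SymPencilSdcPerFourLadder`)

The `7`-dimensional subspaces of `Sing Z(per_4)` are expected to be governed by a trichotomy
(detecting pair of rows / of columns / a cross, val-width-5676-p2 g3).  The natural `6`-dimensional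
analogue "T6" — every `6`-dimensional `V ⊆ Sing Z(per_4)` has a detecting pair of rows or of columns
or lies inside a cross `row l ∪ column c` — is FALSE (`not_sixDim_trichotomy`): the space

  `V₁ = {row 0 = a ∈ K⁴, row 1 = s·(1,1,0,0), row 2 = t·(1,−1,0,0), row 3 = 0}`
  `    = span {E₀₀, E₀₁, E₀₂, E₀₃, E₁₀ + E₁₁, E₂₀ − E₂₁}`

has all `3 × 3` subpermanents zero (rows `1, 2` are "permanent-orthogonal":
`w_c w'_{c'} + w_{c'} w'_c = 0`), dimension `6`, no detecting pair, and is contained in no two-row /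
two-column block and no cross (`exists_exotic_six`).  General shape of the family:
`row a ⊕ K(αE_{bc} + βE_{bc'}) ⊕ K(αE_{b'c} − βE_{b'c'})`.  It was found by an exact first-order
deformation computation at the coordinate `6`-subspaces of `Sing Z(per_4)` (the `7`-dimensional
coordinate points show no excess, consistent with the `7`-dimensional trichotomy).

The same theorem records that `V₁` is HARMLESS for the ladder: at `u₀ = E₁₂ + E₂₁ + E₃₃`,
`per_4 (u₀ + σ y) = σ a₀ + σ² (s a₂ + t (a₁ − a₀))` on `V₁`, a form of rank `4` with `2`-dimensional
radical, so `V₁` carries no `k`-square family of `s²`-coefficients for `k ≤ 3` (common kernel of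
dimension `≥ 3` inside a radical of dimension `2`).  Hence the hypotheses `H6₂`, `H6₃` of
`SymPencilSdcPerFourLadder.twentyFour_le_of` / `twentyFive_le_of` are not refuted by `V₁`; but they
cannot be obtained from "T6", whose hypothesis in
`SymPencilSdcPerFourTrichotomyGlue.twentyFive_le_of_trichotomies` is therefore unsatisfiable — a
corrected classification (including this family) or the "swap" route (rank in `u`) is needed.

Honest framing: a counterexample to an auxiliary conjecture and a calibration; no lower bound, the
crux `SdcSuperquadratic` and `VP ≠ VNP` untouched.  No definitions, no named facts. [folklore]
-/

noncomputable section

-- single-conjunct layout: Sub = Summit, duplicated namespace component intended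
set_option linter.dupNamespace false

namespace Summit.ValiantsHypothesis.ValiantsHypothesis.Theorems.SymPencilPerFourSixDimExotic

open MvPolynomial Module
open Literature.Computability.AlgebraicComplexity
open Summit.ValiantsHypothesis.ValiantsHypothesis.Theorems.SymPencilPerFourCoordinateRadical
open Summit.ValiantsHypothesis.ValiantsHypothesis.Theorems.SymPencilBoxFourEquality

variable {K : Type*} [Field K]

/-- **The exotic `6`-space `V₁ ⊆ Sing Z(per_4)`**: it exists, has dimension `6`, no detecting pair of
rows, none of columns, lies in no cross, and (characteristic `0`) carries no `k`-square family of
`s²`-coefficients for `k ≤ 3`.  See the module docstring for `V₁`. [folklore] -/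
theorem exists_exotic_six [CharZero K] :
    ∃ W : Submodule K (Fin 4 × Fin 4 → K),
      (∀ x ∈ W, ∀ (r c : Fin 3 → Fin 4), Function.Injective r → Function.Injective c →
        ((Matrix.of fun i j => x (i, j)).submatrix r c).permanent = 0) ∧
      finrank K W = 6 ∧
      (∀ p q : Fin 4, p ≠ q → ∃ x ∈ W, x ≠ 0 ∧ (∀ j, x (p, j) = 0) ∧ ∀ j, x (q, j) = 0) ∧
      (∀ p q : Fin 4, p ≠ q → ∃ x ∈ W, x ≠ 0 ∧ (∀ i, x (i, p) = 0) ∧ ∀ i, x (i, q) = 0) ∧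
      (∀ l c : Fin 4, ∃ x ∈ W, ∃ i j : Fin 4, i ≠ l ∧ j ≠ c ∧ x (i, j) ≠ 0) ∧
      ∀ k : ℕ, k ≤ 3 → ∀ c : Fin k → K,
        ¬ (∀ u : Fin 4 × Fin 4 → K, ∃ Λ : Fin k → ((Fin 4 × Fin 4 → K) →ₗ[K] K),
            ∀ y ∈ W, ∃ e₀ e₁ : K, ∀ s : K,
              eval (u + s • y) (perPoly (Fin 4) K) =
                e₀ + s * e₁ + s ^ 2 * ∑ k, c k * (Λ k y) ^ 2) := by
  classical
  have hcases : ∀ i : Fin 4, i = 0 ∨ i = 1 ∨ i = 2 ∨ i = 3 := by decide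
  -- the parametrisation `(a, s, t) ↦ (row 0 = a, row 1 = s(1,1,0,0), row 2 = t(1,-1,0,0), row 3 = 0)`
  let F : (Fin 4 → K) × K × K → (Fin 4 × Fin 4 → K) := fun g p =>
    if p.1 = 0 then g.1 p.2
    else if p.1 = 1 then (if p.2 = 0 then g.2.1 else if p.2 = 1 then g.2.1 else 0)
    else if p.1 = 2 then (if p.2 = 0 then g.2.2 else if p.2 = 1 then -g.2.2 else 0)
    else 0
  have hF : ∀ g p, F g p = (if p.1 = 0 then g.1 p.2
    else if p.1 = 1 then (if p.2 = 0 then g.2.1 else if p.2 = 1 then g.2.1 else 0)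
    else if p.1 = 2 then (if p.2 = 0 then g.2.2 else if p.2 = 1 then -g.2.2 else 0)
    else 0) := fun _ _ => rfl
  let ψ : ((Fin 4 → K) × K × K) →ₗ[K] (Fin 4 × Fin 4 → K) :=
    { toFun := F
      map_add' := fun g g' => by
        funext p; simp only [hF, Prod.fst_add, Prod.snd_add, Pi.add_apply]
        split_ifs <;> ring
      map_smul' := fun r g => by
        funext p; simp only [hF, Prod.smul_fst, Prod.smul_snd, Pi.smul_apply, smul_eq_mul,
          RingHom.id_apply]
        split_ifs <;> ring }
  have hψ : ∀ (a : Fin 4 → K) (s t : K) (i j : Fin 4), ψ (a, s, t) (i, j) =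
      (if i = 0 then a j
        else if i = 1 then (if j = 0 then s else if j = 1 then s else 0)
        else if i = 2 then (if j = 0 then t else if j = 1 then -t else 0) else 0) :=
    fun _ _ _ _ _ => rfl
  -- entries, row by row
  have h0 : ∀ (a : Fin 4 → K) (s t : K) (j : Fin 4), ψ (a, s, t) (0, j) = a j :=
    fun a s t j => by rw [hψ]; simp
  have h10 : ∀ (a : Fin 4 → K) (s t : K), ψ (a, s, t) (1, 0) = s := fun a s t => by
    rw [hψ]; simp
  have h11 : ∀ (a : Fin 4 → K) (s t : K), ψ (a, s, t) (1, 1) = s := fun a s t => by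
    rw [hψ]; simp
  have h12 : ∀ (a : Fin 4 → K) (s t : K), ψ (a, s, t) (1, 2) = 0 := fun a s t => by
    rw [hψ]; simp [show ((2 : Fin 4) = 0) = False by decide, show ((2 : Fin 4) = 1) = False by decide]
  have h13 : ∀ (a : Fin 4 → K) (s t : K), ψ (a, s, t) (1, 3) = 0 := fun a s t => by
    rw [hψ]; simp [show ((3 : Fin 4) = 0) = False by decide, show ((3 : Fin 4) = 1) = False by decide]
  have h20 : ∀ (a : Fin 4 → K) (s t : K), ψ (a, s, t) (2, 0) = t := fun a s t => by
    rw [hψ]; simp [show ((2 : Fin 4) = 0) = False by decide, show ((2 : Fin 4) = 1) = False by decide]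
  have h21 : ∀ (a : Fin 4 → K) (s t : K), ψ (a, s, t) (2, 1) = -t := fun a s t => by
    rw [hψ]; simp [show ((2 : Fin 4) = 0) = False by decide, show ((2 : Fin 4) = 1) = False by decide,
      show ((1 : Fin 4) = 0) = False by decide]
  have h22 : ∀ (a : Fin 4 → K) (s t : K), ψ (a, s, t) (2, 2) = 0 := fun a s t => by
    rw [hψ]; simp [show ((2 : Fin 4) = 0) = False by decide, show ((2 : Fin 4) = 1) = False by decide]
  have h23 : ∀ (a : Fin 4 → K) (s t : K), ψ (a, s, t) (2, 3) = 0 := fun a s t => by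
    rw [hψ]; simp [show ((2 : Fin 4) = 0) = False by decide, show ((2 : Fin 4) = 1) = False by decide,
      show ((3 : Fin 4) = 0) = False by decide, show ((3 : Fin 4) = 1) = False by decide]
  have h3 : ∀ (a : Fin 4 → K) (s t : K) (j : Fin 4), ψ (a, s, t) (3, j) = 0 := fun a s t j => by
    rw [hψ]; simp [show ((3 : Fin 4) = 0) = False by decide, show ((3 : Fin 4) = 1) = False by decide,
      show ((3 : Fin 4) = 2) = False by decide]
  let W : Submodule K (Fin 4 × Fin 4 → K) := LinearMap.range ψ
  have hmem : ∀ x ∈ W, ∃ (a : Fin 4 → K) (s t : K), x = ψ (a, s, t) := by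
    rintro _ ⟨⟨a, s, t⟩, rfl⟩
    exact ⟨a, s, t, rfl⟩
  have hWmem : ∀ (a : Fin 4 → K) (s t : K), ψ (a, s, t) ∈ W := fun a s t => ⟨(a, s, t), rfl⟩
  -- the sixteen `3 × 3` subpermanents vanish
  have e00 : (0 : Fin 4).succAbove 0 = 1 := by decide
  have e01 : (0 : Fin 4).succAbove 1 = 2 := by decide
  have e02 : (0 : Fin 4).succAbove 2 = 3 := by decide
  have e10 : (1 : Fin 4).succAbove 0 = 0 := by decide
  have e11 : (1 : Fin 4).succAbove 1 = 2 := by decide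
  have e12 : (1 : Fin 4).succAbove 2 = 3 := by decide
  have e20 : (2 : Fin 4).succAbove 0 = 0 := by decide
  have e21 : (2 : Fin 4).succAbove 1 = 1 := by decide
  have e22 : (2 : Fin 4).succAbove 2 = 3 := by decide
  have e30 : (3 : Fin 4).succAbove 0 = 0 := by decide
  have e31 : (3 : Fin 4).succAbove 1 = 1 := by decide
  have e32 : (3 : Fin 4).succAbove 2 = 2 := by decide
  have hSing : ∀ x ∈ W, ∀ (r c : Fin 3 → Fin 4), Function.Injective r → Function.Injective c →
      ((Matrix.of fun i j => x (i, j)).submatrix r c).permanent = 0 := by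
    intro x hx
    obtain ⟨a, s, t, rfl⟩ := hmem x hx
    refine subperm_vanish_inj_of_succAbove _ fun r c => ?_
    rcases hcases r with rfl | rfl | rfl | rfl <;> rcases hcases c with rfl | rfl | rfl | rfl <;>
      · simp only [Matrix.permanent_fin_three_row, Matrix.submatrix_apply, Matrix.of_apply,
          e00, e01, e02, e10, e11, e12, e20, e21, e22, e30, e31, e32,
          h0, h10, h11, h12, h13, h20, h21, h22, h23, h3]
        ring
  -- dimension `6`
  have hinj : Function.Injective ψ := by
    refine (injective_iff_map_eq_zero ψ).2 fun g hg => ?_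
    obtain ⟨a, s, t⟩ := g
    have ha : a = 0 := by
      funext j
      have h := congr_fun hg (0, j)
      rwa [h0] at h
    have hs : s = 0 := by have h := congr_fun hg (1, 0); rwa [h10] at h
    have ht : t = 0 := by have h := congr_fun hg (2, 0); rwa [h20] at h
    rw [ha, hs, ht]; rfl
  have hW6 : finrank K W = 6 := by
    rw [LinearMap.finrank_range_of_inj hinj, Module.finrank_prod, Module.finrank_prod,
      finrank_fintype_fun_eq_card, Fintype.card_fin, Module.finrank_self]
  -- the three basic witnesses
  have hne_row0 : ∀ j : Fin 4, ψ (Pi.single j 1, 0, 0) ≠ 0 := fun j h => by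
    have := congr_fun h (0, j)
    rw [h0, Pi.zero_apply] at this
    simp at this
  have hne_s : ψ (0, 1, 0) ≠ 0 := fun h => by
    have := congr_fun h (1, 0)
    rw [h10, Pi.zero_apply] at this
    exact one_ne_zero this
  have hne_t : ψ (0, 0, 1) ≠ 0 := fun h => by
    have := congr_fun h (2, 0)
    rw [h20, Pi.zero_apply] at this
    exact one_ne_zero this
  -- rows of the witnesses
  have hrow_ne0 : ∀ (s t : K) (p : Fin 4), p ≠ 0 → p ≠ 1 → ∀ j, ψ (0, s, 0) (p, j) = 0 := by
    intro s t p hp0 hp1 j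
    rcases hcases p with rfl | rfl | rfl | rfl
    · exact absurd rfl hp0
    · exact absurd rfl hp1
    · rcases hcases j with rfl | rfl | rfl | rfl
      · rw [h20]
      · rw [h21, neg_zero]
      · rw [h22]
      · rw [h23]
    · exact h3 _ _ _ j
  have hrow_t : ∀ (p : Fin 4), p ≠ 0 → p ≠ 2 → ∀ j, ψ (0, 0, 1) (p, j) = 0 := by
    intro p hp0 hp2 j
    rcases hcases p with rfl | rfl | rfl | rfl
    · exact absurd rfl hp0
    · rcases hcases j with rfl | rfl | rfl | rfl
      · rw [h10]
      · rw [h11]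
      · rw [h12]
      · rw [h13]
    · exact absurd rfl hp2
    · exact h3 _ _ _ j
  have hrow_a : ∀ (a : Fin 4 → K) (p : Fin 4), p ≠ 0 → ∀ j, ψ (a, 0, 0) (p, j) = 0 := by
    intro a p hp0 j
    rcases hcases p with rfl | rfl | rfl | rfl
    · exact absurd rfl hp0
    · rcases hcases j with rfl | rfl | rfl | rfl
      · rw [h10]
      · rw [h11]
      · rw [h12]
      · rw [h13]
    · rcases hcases j with rfl | rfl | rfl | rfl
      · rw [h20]
      · rw [h21, neg_zero]
      · rw [h22]
      · rw [h23]
    · exact h3 _ _ _ j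
  refine ⟨W, hSing, hW6, ?_, ?_, ?_, ?_⟩
  · -- no detecting pair of rows
    intro p q hpq
    by_cases hp0 : p = 0
    · subst hp0
      rcases hcases q with rfl | rfl | rfl | rfl
      · exact absurd rfl hpq
      · exact ⟨_, hWmem 0 0 1, hne_t, fun j => by rw [h0]; rfl, hrow_t 1 (by decide) (by decide)⟩
      · exact ⟨_, hWmem 0 1 0, hne_s, fun j => by rw [h0]; rfl,
          hrow_ne0 1 0 2 (by decide) (by decide)⟩
      · exact ⟨_, hWmem 0 1 0, hne_s, fun j => by rw [h0]; rfl,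
          hrow_ne0 1 0 3 (by decide) (by decide)⟩
    by_cases hq0 : q = 0
    · subst hq0
      rcases hcases p with rfl | rfl | rfl | rfl
      · exact absurd rfl hp0
      · exact ⟨_, hWmem 0 0 1, hne_t, hrow_t 1 (by decide) (by decide), fun j => by rw [h0]; rfl⟩
      · exact ⟨_, hWmem 0 1 0, hne_s, hrow_ne0 1 0 2 (by decide) (by decide),
          fun j => by rw [h0]; rfl⟩
      · exact ⟨_, hWmem 0 1 0, hne_s, hrow_ne0 1 0 3 (by decide) (by decide),
          fun j => by rw [h0]; rfl⟩
    exact ⟨_, hWmem (Pi.single 0 1) 0 0, hne_row0 0, hrow_a _ p hp0, hrow_a _ q hq0⟩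
  · -- no detecting pair of columns: a row-`0` vector in a third column
    intro p q hpq
    have hthird : ∀ p q : Fin 4, ∃ j : Fin 4, j ≠ p ∧ j ≠ q := by decide
    obtain ⟨j, hjp, hjq⟩ := hthird p q
    refine ⟨_, hWmem (Pi.single j 1) 0 0, hne_row0 j, fun i => ?_, fun i => ?_⟩
    · by_cases hi : i = 0
      · subst hi; rw [h0]; simp [hjp.symm]
      · exact hrow_a _ i hi p
    · by_cases hi : i = 0
      · subst hi; rw [h0]; simp [hjq.symm]
      · exact hrow_a _ i hi q
  · -- in no cross `row l ∪ column c`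
    intro l c
    by_cases hl : l = 0
    · subst hl
      by_cases hc : c = 0
      · subst hc
        exact ⟨_, hWmem 0 1 0, 1, 1, by decide, by decide, by rw [h11]; exact one_ne_zero⟩
      · exact ⟨_, hWmem 0 1 0, 1, 0, by decide, Ne.symm hc, by rw [h10]; exact one_ne_zero⟩
    · have hthird : ∀ c : Fin 4, ∃ j : Fin 4, j ≠ c := by decide
      obtain ⟨j, hjc⟩ := hthird c
      exact ⟨_, hWmem (Pi.single j 1) 0 0, 0, j, Ne.symm hl, hjc, by rw [h0]; simp⟩
  · -- no `k`-square family for `k ≤ 3`: base point `u₀ = E₁₂ + E₂₁ + E₃₃`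
    intro k hk c hfam
    obtain ⟨Λ, hΛ⟩ := hfam (fun p : Fin 4 × Fin 4 =>
      if p = (1, 2) then (1 : K) else if p = (2, 1) then 1 else if p = (3, 3) then 1 else 0)
    -- the expansion at `u₀`
    have hev : ∀ (a : Fin 4 → K) (s t σ : K),
        eval ((fun p : Fin 4 × Fin 4 =>
          if p = (1, 2) then (1 : K) else if p = (2, 1) then 1 else if p = (3, 3) then 1 else 0) +
            σ • ψ (a, s, t)) (perPoly (Fin 4) K) =
          σ * a 0 + σ ^ 2 * (s * a 2 + t * (a 1 - a 0)) := by
      intro a s t σ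
      rw [eval_perPoly, Matrix.permanent_fin_four_row]
      simp only [Matrix.of_apply, Pi.add_apply, Pi.smul_apply, smul_eq_mul, Prod.mk.injEq,
        h0, h10, h11, h12, h13, h20, h21, h22, h23, h3,
        show ((0 : Fin 4) = 1) = False by decide, show ((0 : Fin 4) = 2) = False by decide,
        show ((0 : Fin 4) = 3) = False by decide, show ((1 : Fin 4) = 2) = False by decide,
        show ((1 : Fin 4) = 3) = False by decide, show ((2 : Fin 4) = 1) = False by decide,
        show ((2 : Fin 4) = 3) = False by decide, show ((3 : Fin 4) = 1) = False by decide,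
        show ((3 : Fin 4) = 2) = False by decide,
        and_true, and_false, and_self, if_true, if_false, add_zero, zero_add,
        mul_zero, mul_one]
      ring
    -- `Σ c_k Λ_k(y)² = s a₂ + t (a₁ − a₀)` on `W`
    have hG : ∀ (a : Fin 4 → K) (s t : K),
        ∑ i, c i * (Λ i (ψ (a, s, t))) ^ 2 = s * a 2 + t * (a 1 - a 0) := by
      intro a s t
      obtain ⟨e₀, e₁, he⟩ := hΛ _ (hWmem a s t)
      have P : ∀ σ : K, e₀ + σ * e₁ + σ ^ 2 * ∑ i, c i * (Λ i (ψ (a, s, t))) ^ 2 =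
          σ * a 0 + σ ^ 2 * (s * a 2 + t * (a 1 - a 0)) := fun σ => by rw [← he σ, hev]
      have q0 := P 0; have q1 := P 1; have q1' := P (-1)
      have h2 : (2 : K) * ∑ i, c i * (Λ i (ψ (a, s, t))) ^ 2 =
          2 * (s * a 2 + t * (a 1 - a 0)) := by linear_combination q1 + q1' - 2 * q0
      exact (mul_right_inj' two_ne_zero).1 h2
    -- common kernel `N ≤ W`, `dim N ≥ 6 − k ≥ 3`
    obtain ⟨N, hNW, hdim, hN⟩ := exists_commonKernel W Λ
    rw [hW6, Fintype.card_fin] at hdim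
    have hGadd : ∀ x₀ ∈ N, ∀ y ∈ W,
        ∑ i, c i * (Λ i (x₀ + y)) ^ 2 = ∑ i, c i * (Λ i y) ^ 2 := by
      intro x₀ hx₀ y _
      refine Finset.sum_congr rfl fun i _ => ?_
      rw [map_add, hN x₀ hx₀ i, zero_add]
    -- an element of `N` has `s = t = 0`, `a₂ = 0`, `a₁ = a₀`
    have hNshape : ∀ x₀ ∈ N, ∃ a : Fin 4 → K, x₀ = ψ (a, 0, 0) ∧ a 2 = 0 ∧ a 1 = a 0 := by
      intro x₀ hx₀
      obtain ⟨a, s, t, rfl⟩ := hmem x₀ (hNW hx₀)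
      have hz : s * a 2 + t * (a 1 - a 0) = 0 := by
        have h := hGadd _ hx₀ 0 W.zero_mem
        rw [add_zero, hG] at h
        simpa using h
      have test : ∀ (a' : Fin 4 → K) (s' t' : K),
          (s + s') * (a 2 + a' 2) + (t + t') * ((a 1 + a' 1) - (a 0 + a' 0)) =
            s' * a' 2 + t' * (a' 1 - a' 0) := by
        intro a' s' t'
        have h := hGadd _ hx₀ _ (hWmem a' s' t')
        rw [← map_add, Prod.mk_add_mk, Prod.mk_add_mk, hG, hG] at h
        simpa only [Pi.add_apply] using h
      have t1 := test (Pi.single 2 1) 0 0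
      have t2 := test 0 1 0
      have t3 := test (Pi.single 1 1) 0 0
      have t4 := test 0 0 1
      simp only [Pi.single_apply, Pi.zero_apply, show ((2 : Fin 4) = 1) = False by decide,
        show ((1 : Fin 4) = 2) = False by decide, show ((0 : Fin 4) = 2) = False by decide,
        show ((0 : Fin 4) = 1) = False by decide, if_true, if_false, add_zero,
        mul_zero, mul_one, sub_zero] at t1 t2 t3 t4
      have hs : s = 0 := by linear_combination t1 - hz
      have ht : t = 0 := by linear_combination t3 - hz
      have ha2 : a 2 = 0 := by linear_combination t2 - hz
      have ha1 : a 1 = a 0 := by linear_combination t4 - hz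
      exact ⟨a, by rw [hs, ht], ha2, ha1⟩
    -- `x₀ ↦ (x₀ (0,0), x₀ (0,3))` is injective on `N`, so `dim N ≤ 2`
    let θ : ↥N →ₗ[K] K × K :=
      ((LinearMap.proj ((0 : Fin 4), (0 : Fin 4)) : (Fin 4 × Fin 4 → K) →ₗ[K] K).prod
        (LinearMap.proj ((0 : Fin 4), (3 : Fin 4)) : (Fin 4 × Fin 4 → K) →ₗ[K] K)).comp N.subtype
    have hθ : ∀ z : ↥N, θ z = ((z : Fin 4 × Fin 4 → K) (0, 0), (z : Fin 4 × Fin 4 → K) (0, 3)) :=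
      fun _ => rfl
    have hθker : LinearMap.ker θ = ⊥ := by
      rw [eq_bot_iff]
      rintro ⟨x₀, hx₀⟩ hθ0
      rw [LinearMap.mem_ker, hθ, Prod.mk_eq_zero] at hθ0
      obtain ⟨a, hxa, ha2, ha1⟩ := hNshape x₀ hx₀
      rw [Submodule.mem_bot, Subtype.ext_iff, Submodule.coe_mk, Submodule.coe_zero, hxa]
      have ha0 : a 0 = 0 := by
        have h := hθ0.1
        change x₀ (0, 0) = 0 at h
        rwa [hxa, h0] at h
      have ha3 : a 3 = 0 := by
        have h := hθ0.2
        change x₀ (0, 3) = 0 at h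
        rwa [hxa, h0] at h
      have ha : a = 0 := by
        funext j
        rcases hcases j with rfl | rfl | rfl | rfl
        · exact ha0
        · rw [ha1, ha0]; rfl
        · exact ha2
        · exact ha3
      rw [ha]
      exact map_zero ψ
    have hN2 : finrank K N ≤ 2 := by
      have h := θ.finrank_range_add_finrank_ker
      rw [hθker, finrank_bot, add_zero] at h
      have h2 := (LinearMap.range θ).finrank_le
      rw [Module.finrank_prod, Module.finrank_self] at h2
      omega
    omega

/-- **"T6" is false**: it is NOT the case that every `6`-dimensional subspace of `Sing Z(per_4)`
has a detecting pair of rows, or of columns, or lies inside a cross. [folklore] -/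
theorem not_sixDim_trichotomy [CharZero K] :
    ¬ (∀ W : Submodule K (Fin 4 × Fin 4 → K),
      (∀ x ∈ W, ∀ (r c : Fin 3 → Fin 4), Function.Injective r → Function.Injective c →
        ((Matrix.of fun i j => x (i, j)).submatrix r c).permanent = 0) →
      finrank K W = 6 →
      (∃ p q : Fin 4, p ≠ q ∧ ∀ x ∈ W, (∀ j, x (p, j) = 0) → (∀ j, x (q, j) = 0) → x = 0) ∨
      (∃ p q : Fin 4, p ≠ q ∧ ∀ x ∈ W, (∀ i, x (i, p) = 0) → (∀ i, x (i, q) = 0) → x = 0) ∨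
      (∃ l c : Fin 4, ∀ x ∈ W, ∀ i j : Fin 4, i ≠ l → j ≠ c → x (i, j) = 0)) := by
  intro T6
  obtain ⟨W, hSing, h6, hrows, hcols, hcross, -⟩ := (exists_exotic_six (K := K))
  rcases T6 W hSing h6 with ⟨p, q, hpq, hdet⟩ | ⟨p, q, hpq, hdet⟩ | ⟨l, c, hX⟩
  · obtain ⟨x, hx, hne, hp, hq⟩ := hrows p q hpq
    exact hne (hdet x hx hp hq)
  · obtain ⟨x, hx, hne, hp, hq⟩ := hcols p q hpq
    exact hne (hdet x hx hp hq)
  · obtain ⟨x, hx, i, j, hi, hj, hne⟩ := hcross l c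
    exact hne (hX x hx i j hi hj)

end Summit.ValiantsHypothesis.ValiantsHypothesis.Theorems.SymPencilPerFourSixDimExotic

end
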